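import Mathlib
import HarnessLib
import Summits.Ventures.LatticeQCDFlow.Scoring.IMHLogNormalAcceptance

/-!
# The log-normal model of exact flow-MCMC, LOSS LEG: forward loss `E_p[log w] = s/2` (= the reverse
# loss), hence in the model `ESS = e^{−2·KL}` and `ā = erfc(√(KL/2))` EXACTLY

HONEST FRAMING: exact (Metropolis-corrected) sampling algorithms for lattice gauge theory;
figures of merit are autocorrelation/cost numbers at stated couplings and volumes; no
continuum-physics claim.

Venture `LatticeQCDFlow` (cell pub-lqcd), topic `Scoring`; FANOUT row 3 (`s0-u1-a`, S0-B
implementation A, GEN-20).  NEW WORK of the cell — a short completion of the flow seat's dictionary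
file `Scoring/IMHLogNormalAcceptance` (imported: `noiseLaw s = N(−s/2, s)` is the model law of
`ℓ = log w`, `integral_exp_mul_noiseLaw` moves `e^ℓ` onto the measure, `ā = erfc(σ/2)`,
`imh_lognormal_dictionary`) and of T2-J `Scaling/GaussianWeights` (`gaussian_logweight_reverseKL`:
the REVERSE loss `E_q[−ℓ] = v/2`; its docstring lists the forward loss as "not formalised" — done
here); NO definition is introduced; nothing is cited.

## Content (all `[ours]`)

* `integral_neg_id_noiseLaw` — `∫ (−x) dN(−s/2, s) = s/2` (reverse loss `KL(q‖p) = E_q[−log w]`);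
* **`integral_exp_mul_id_noiseLaw`** — `∫ e^x·x dN(−s/2, s) = s/2`: the FORWARD loss
  `KL(p‖q) = E_p[log w] = E_q[w log w]` equals the reverse loss in the log-normal model;
* **`imh_lognormal_accRate_eq_erfc_loss`** — `ā = (2/√π)∫_{√(D/2)}^∞ e^{−u²} du` with
  `D = ∫(−x) dN(−s/2, s)` the model's training loss: `ā = erfc(√(KL/2))` EXACTLY in the model;
* **`imh_lognormal_loss_dictionary`** — over an abstract model space as in `imh_lognormal_dictionary`:
  `ℓ ∼ N(m, v)` under `P`, `E e^ℓ = 1` ⇒ `E[−ℓ] = v/2 ∧ E[e^ℓ ℓ] = v/2 ∧ ESS = e^{−2(v/2)} ∧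
  ā = (2/√π)∫_{√((v/2)/2)}^∞ e^{−u²} du`.

Reading (value-free): the scorers' one-parameter log-normal dictionary can be keyed by the TRAINING
LOSS instead of the log-weight variance: `s = 2·KL`, `ESS = e^{−2KL}`, `ā = erfc(√(KL/2))`; row 3's
GEN-20 `Scaling/AcceptanceAlongCouplingSequences` / `Scaling/LossEssDictionary` prove that the
untrained factorised sampler obeys exactly this conversion in the large-volume limit.
NOT CLAIMED: that a trained flow's log-weight is Gaussian (a model); any value at the cell's `(β, L)`;
nothing re-scored.
-/

noncomputable section

namespace Summit.Ventures.LatticeQCDFlow.Scoring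

open MeasureTheory ProbabilityTheory Set
open scoped NNReal ENNReal
open Literature.Probability.Distributions
open Literature.Probability.Distributions.PseudoMarginalNoise

section LossLeg

variable {s : ℝ≥0}

/-- **The reverse loss of the model**: `∫ (−x) dN(−s/2, s) = s/2` (`= E_q[−log w] = KL(q‖p)`). [ours] -/
theorem integral_neg_id_noiseLaw (s : ℝ≥0) : ∫ x, -x ∂(noiseLaw s) = (s : ℝ) / 2 := by
  rw [integral_neg, noiseLaw, integral_id_gaussianReal]
  ring

/-- **THE FORWARD LOSS OF THE MODEL EQUALS THE REVERSE LOSS**: `∫ e^x·x dN(−s/2, s) = s/2`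
(`= E_q[w log w] = E_p[log w] = KL(p‖q)`; the tilt by `e^x` turns `N(−s/2, s)` into `N(s/2, s)`).
[ours] -/
theorem integral_exp_mul_id_noiseLaw (s : ℝ≥0) : ∫ x, Real.exp x * x ∂(noiseLaw s) = (s : ℝ) / 2 := by
  rcases eq_or_ne s 0 with hs | hs
  · subst hs
    simp [noiseLaw, gaussianReal_zero_var, integral_dirac]
  · rw [integral_exp_mul_noiseLaw hs (fun x => x), tiltedLaw, integral_id_gaussianReal]

/-- The symmetric (Jeffreys) loss of the model is the log-weight variance: `E_q[−ℓ] + E_p[ℓ] = s`.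
[ours] -/
theorem imh_lognormal_jeffreys (s : ℝ≥0) :
    (∫ x, -x ∂(noiseLaw s)) + ∫ x, Real.exp x * x ∂(noiseLaw s) = (s : ℝ) := by
  rw [integral_neg_id_noiseLaw, integral_exp_mul_id_noiseLaw]
  ring

/-- **`ā = erfc(√(KL/2))` EXACTLY IN THE LOG-NORMAL MODEL**: with `D = ∫(−x) dN(−s/2, s)` the model's
reverse training loss, the stationary IMH acceptance is `(2/√π)∫_{√(D/2)}^∞ e^{−u²} du`. [ours] -/
theorem imh_lognormal_accRate_eq_erfc_loss (hs : s ≠ 0) :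
    ∫ x, ∫ y, min (Real.exp x) (Real.exp y) ∂(noiseLaw s) ∂(noiseLaw s) =
      2 / Real.sqrt Real.pi
        * ∫ u in Ioi (Real.sqrt ((∫ x, -x ∂(noiseLaw s)) / 2)), Real.exp (-u ^ 2) := by
  rw [imh_lognormal_accRate_eq_erfc hs, integral_neg_id_noiseLaw]
  congr 3
  rw [div_div, show (2 : ℝ) * 2 = 2 ^ 2 by norm_num, Real.sqrt_div (NNReal.coe_nonneg s),
    Real.sqrt_sq zero_le_two]

/-- **`ESS = e^{−2·KL}` in the model**: the Kish fraction `e^{−s}` written through the loss. [ours] -/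
theorem exp_neg_eq_exp_neg_two_mul_loss (s : ℝ≥0) :
    Real.exp (-(s : ℝ)) = Real.exp (-(2 * ∫ x, -x ∂(noiseLaw s))) := by
  rw [integral_neg_id_noiseLaw]
  ring_nf

end LossLeg

section Dictionary

/-- **THE LOG-NORMAL DICTIONARY KEYED BY THE LOSS** (abstract model space, interface of
`imh_lognormal_dictionary`): if `ℓ = log w ∼ N(m, v)` under the model `P` (`v ≠ 0`) with
`E e^ℓ = mgf ℓ P 1 = 1`, then the reverse loss `E[−ℓ] = v/2`, the forward loss `E[e^ℓ·ℓ] = v/2`,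
`ESS/N = e^{−2·(v/2)}` and the stationary acceptance is `(2/√π)∫_{√((v/2)/2)}^∞ e^{−u²} du`:
`ā = erfc(√(KL/2))`, `ESS = e^{−2KL}`. [ours] -/
theorem imh_lognormal_loss_dictionary {Ω : Type*} [MeasurableSpace Ω] {P : Measure Ω}
    [IsProbabilityMeasure P] {ℓ : Ω → ℝ} (hℓm : AEMeasurable ℓ P) {m : ℝ} {v : ℝ≥0} (hv : v ≠ 0)
    (hℓ : P.map ℓ = gaussianReal m v) (hnorm : mgf ℓ P 1 = 1) :
    ∫ ω, -ℓ ω ∂P = (v : ℝ) / 2 ∧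
    ∫ ω, Real.exp (ℓ ω) * ℓ ω ∂P = (v : ℝ) / 2 ∧
    mgf ℓ P 1 ^ 2 / mgf ℓ P 2 = Real.exp (-(2 * ((v : ℝ) / 2))) ∧
    ∫ ω, ∫ ω', min (Real.exp (ℓ ω)) (Real.exp (ℓ ω')) ∂P ∂P =
      2 / Real.sqrt Real.pi * ∫ u in Ioi (Real.sqrt ((v : ℝ) / 2 / 2)), Real.exp (-u ^ 2) := by
  obtain ⟨hess, hacc⟩ := imh_lognormal_dictionary hℓm hv hℓ hnorm
  have hm : m = -(v : ℝ) / 2 := (Theory2.gaussian_logweight_law hℓ hnorm).1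
  have hlaw : P.map ℓ = noiseLaw v := by rw [hℓ, hm, noiseLaw, neg_div]
  refine ⟨Theory2.gaussian_logweight_reverseKL hℓm hℓ hnorm, ?_, ?_, ?_⟩
  · have h := integral_map hℓm (f := fun x : ℝ => Real.exp x * x)
      ((Real.continuous_exp.mul continuous_id).aestronglyMeasurable)
    rw [hlaw, integral_exp_mul_id_noiseLaw] at h
    exact h.symm
  · rw [hess]; ring_nf
  · rw [hacc]
    congr 3
    rw [div_div, show (2 : ℝ) * 2 = 2 ^ 2 by norm_num, Real.sqrt_div (NNReal.coe_nonneg v),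
      Real.sqrt_sq zero_le_two]

end Dictionary

end Summit.Ventures.LatticeQCDFlow.Scoring

end
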